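import Literature.Analysis.Complex.StripContourShift
import Mathlib.Analysis.SpecialFunctions.JapaneseBracket
import Mathlib.MeasureTheory.Integral.IntegralEqImproper
import Mathlib.Analysis.SpecialFunctions.ImproperIntegrals
import HarnessLib

/-!
# Line integrals of an entire test function of exponential type (Paley–Wiener calculus)

Topic `Literature/Analysis/Fourier`. Everything here is PROVED (theorems only; no definitions, no
named facts). The setting is an entire function `h : ℂ → ℂ` with

  `‖h(z)‖ ≤ C e^{|im z|} / (1 + |re z|)^N`  (`N ≥ 2`),

i.e. of exponential type `≤ 1` with polynomial decay along horizontal lines (for instance the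
Fourier transform of a smooth even function supported in `[−1, 1]`, or Ingham's product
`∏ (sin(a_k t)/(a_k t))²`). Its transform is written out as `ξ ↦ ∫ e^{-iuξ} h(u) du`.

* `integral_cexp_mul_shift` — **complex translation**: `∫ e^{-iuξ} h(u + iy) du = e^{-yξ} ∫ e^{-iuξ} h(u) du`
  (contour shift in a horizontal strip, `Literature.Analysis.Complex.integral_eq_integral_add_mul_I_of_strip`).
* `integral_cexp_mul_eq_zero_of_one_lt_abs` — **Paley–Wiener, easy half**: the transform vanishes
  for `|ξ| > 1` (let `y → ∓∞`).
* `integral_cexp_mul_even`, `conj_integral_cexp_mul` — the transform is even and real when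
  `h(−z) = h(z)`, `h(conj z) = conj h(z)`; `norm_integral_cexp_mul_le` — it is bounded by `C ∫(1+|u|)^{-N}`.
* `integral_cexp_mul_scaled_shift` — **the twisted integral of the scaled kernel**:
  `∫ e^{-iyω} h(L(y − t₀) − iLη) dy = L⁻¹ e^{-it₀ω} e^{ηω} ∫ e^{-iu(ω/L)} h(u) du`, independent of `η`
  up to the explicit factor `e^{ηω}` (this is the computation of the prime-power side of the
  explicit formula with the test function `h(L(· − t))` on a line at distance `η` from the critical
  line: K. Soundararajan, *Strong multiplicity one for the Selberg class*, arXiv:math/0210299, (7)).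
* `norm_scaled_kernel_le`, `integral_norm_scaled_kernel_le` — pointwise and `L¹` bounds for
  `y ↦ h(L(y − t₀) − iLη)`; `norm_intervalIntegral_sub_integral_le` — truncation of a line integral.

## References

* R. E. A. C. Paley, N. Wiener, *Fourier transforms in the complex domain* (1934), Thm. X
  (folklore form: entire of exponential type `σ` and `L¹` on `ℝ` ⇒ transform supported in `[−σ, σ]`).
* K. Soundararajan, arXiv:math/0210299, displays (5)–(7). [Soundararajan2002]
-/

noncomputable section

open Complex Filter Topology Set MeasureTheory
open scoped ComplexConjugate

namespace Literature.Analysis.Fourier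

open Literature.Analysis.Complex

/-! ### Entire functions of exponential type `≤ 1` with polynomial decay along horizontal lines

Throughout, `h : ℂ → ℂ` is entire with `‖h(z)‖ ≤ C e^{|im z|}/(1 + |re z|)^N` (`N ≥ 2`). Its Fourier
transform is written out as `ξ ↦ ∫ e^{-iuξ} h(u) du` (no `2π` in the phase). -/

variable {h : ℂ → ℂ} {C : ℝ} {N : ℕ}

/-- The majorant `(1 + |u|)^{-N}` is integrable on `ℝ` for `N ≥ 2`. [folklore] -/
theorem integrable_inv_one_add_abs_pow (hN : 2 ≤ N) :
    Integrable fun u : ℝ ↦ 1 / (1 + |u|) ^ N := by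
  have h := integrable_one_add_norm (E := ℝ) (μ := volume) (r := N) (by simp; exact_mod_cast (by omega : 1 < N))
  refine h.congr (ae_of_all _ fun u ↦ ?_)
  simp only [Real.norm_eq_abs, one_div]
  rw [Real.rpow_neg (by positivity), Real.rpow_natCast]

/-- On every horizontal line `im z = y`, `u ↦ h(u + iy)` is dominated by `C e^{|y|}/(1+|u|)^N`
and hence integrable. [folklore] -/
theorem integrable_line (hh : Differentiable ℂ h)
    (hb : ∀ z : ℂ, ‖h z‖ ≤ C * Real.exp |z.im| / (1 + |z.re|) ^ N) (hN : 2 ≤ N) (y : ℝ) :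
    Integrable fun u : ℝ ↦ h (u + y * I) := by
  have hc : Continuous fun u : ℝ ↦ h (u + y * I) := hh.continuous.comp (by fun_prop)
  refine ((integrable_inv_one_add_abs_pow hN).const_mul (C * Real.exp |y|)).mono' hc.aestronglyMeasurable
    (ae_of_all _ fun u ↦ ?_)
  have := hb (u + y * I)
  simp only [add_im, ofReal_im, mul_im, ofReal_re, I_im, mul_one, I_re, mul_zero, add_zero, zero_add,
    add_re, mul_re, sub_self] at this
  convert this using 1
  ring

/-- **The complex translation identity** (contour shift in the strip between `im z = 0` and
`im z = y`): `∫ e^{-iuξ} h(u + iy) du = e^{-yξ} ∫ e^{-iuξ} h(u) du`. [folklore] -/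
theorem integral_cexp_mul_shift (hh : Differentiable ℂ h)
    (hb : ∀ z : ℂ, ‖h z‖ ≤ C * Real.exp |z.im| / (1 + |z.re|) ^ N) (hN : 2 ≤ N) (ξ y : ℝ) :
    ∫ u : ℝ, cexp (-I * u * ξ) * h (u + y * I) =
      Real.exp (-(y * ξ)) * ∫ u : ℝ, cexp (-I * u * ξ) * h u := by
  -- the entire function `g(z) = e^{-izξ} h(z)` and its majorant on the strip
  set g : ℂ → ℂ := fun z ↦ cexp (-I * z * ξ) * h z with hg
  have hgd : Differentiable ℂ g := by
    simp only [hg]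
    exact (((differentiable_const _).mul differentiable_id).mul (differentiable_const _)).cexp.mul hh
  have hnorm_exp : ∀ z : ℂ, ‖cexp (-I * z * ξ)‖ = Real.exp (z.im * ξ) := by
    intro z
    rw [Complex.norm_exp]
    congr 1
    simp [Complex.mul_re, Complex.mul_im]
  set b : ℝ → ℝ := fun x ↦ C * Real.exp (|y| * |ξ| + |y|) * (1 / (1 + |x|) ^ N) with hbdef
  have hgb : ∀ z : ℂ, |z.im| ≤ |y| → ‖g z‖ ≤ b z.re := by
    intro z hz
    have h1 := hb z
    have hC : 0 ≤ C := by
      have := (norm_nonneg _).trans (hb 0)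
      simp at this
      linarith
    simp only [hg, hbdef, norm_mul, hnorm_exp z]
    have h2 : Real.exp (z.im * ξ) ≤ Real.exp (|y| * |ξ|) := by
      refine Real.exp_le_exp.mpr ?_
      calc z.im * ξ ≤ |z.im * ξ| := le_abs_self _
        _ = |z.im| * |ξ| := abs_mul _ _
        _ ≤ |y| * |ξ| := mul_le_mul_of_nonneg_right hz (abs_nonneg ξ)
    have h3 : Real.exp |z.im| ≤ Real.exp |y| := Real.exp_le_exp.mpr hz
    have hpos : 0 < (1 + |z.re|) ^ N := by positivity
    calc Real.exp (z.im * ξ) * ‖h z‖ ≤ Real.exp (|y| * |ξ|) * (C * Real.exp |y| / (1 + |z.re|) ^ N) := by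
          refine mul_le_mul h2 (h1.trans ?_) (norm_nonneg _) (Real.exp_pos _).le
          gcongr
      _ = C * Real.exp (|y| * |ξ| + |y|) * (1 / (1 + |z.re|) ^ N) := by
          rw [Real.exp_add]; field_simp
  have hbi : Integrable b := (integrable_inv_one_add_abs_pow hN).const_mul _
  have hb0 : Tendsto (fun x : ℝ ↦ 1 / (1 + |x|) ^ N) atTop (𝓝 0) := by
    have h1 : Tendsto (fun x : ℝ ↦ (1 + |x|) ^ N) atTop atTop := by
      refine (tendsto_pow_atTop (by omega)).comp ?_
      exact tendsto_atTop_add_const_left _ 1 (tendsto_abs_atTop_atTop)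
    have := h1.inv_tendsto_atTop
    simpa [Pi.inv_def, one_div] using this
  have hb0' : Tendsto (fun x : ℝ ↦ 1 / (1 + |x|) ^ N) atBot (𝓝 0) := by
    have h1 : Tendsto (fun x : ℝ ↦ (1 + |x|) ^ N) atBot atTop := by
      refine (tendsto_pow_atTop (by omega)).comp ?_
      exact tendsto_atTop_add_const_left _ 1 (tendsto_abs_atBot_atTop)
    have := h1.inv_tendsto_atTop
    simpa [Pi.inv_def, one_div] using this
  have htop : Tendsto b atTop (𝓝 0) := by simpa [hbdef] using hb0.const_mul (C * Real.exp (|y| * |ξ| + |y|))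
  have hbot : Tendsto b atBot (𝓝 0) := by simpa [hbdef] using hb0'.const_mul (C * Real.exp (|y| * |ξ| + |y|))
  -- shift
  have key : ∫ x : ℝ, g x = ∫ x : ℝ, g (x + y * I) := by
    rcases le_or_gt 0 y with hy | hy
    · exact integral_eq_integral_add_mul_I_of_strip hy hgd.continuous.continuousOn hgd.differentiableOn
        (fun z h0 h1 ↦ hgb z (by rw [abs_of_nonneg h0, abs_of_nonneg hy]; exact h1)) hbi htop hbot
    · have := integral_eq_integral_sub_mul_I_of_strip (Y := -y) (by linarith) hgd.continuous.continuousOn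
        hgd.differentiableOn (fun z h0 h1 ↦ hgb z (by
          rw [abs_of_nonpos h1, abs_of_neg hy]; linarith)) hbi htop hbot
      simpa using this
  -- unfold `g` on the shifted line
  have hline : ∀ x : ℝ, g (x + y * I) = Real.exp (y * ξ) * (cexp (-I * x * ξ) * h (x + y * I)) := by
    intro x
    simp only [hg]
    have : cexp (-I * (x + y * I) * ξ) = Real.exp (y * ξ) * cexp (-I * x * ξ) := by
      rw [show -I * ((x : ℂ) + y * I) * ξ = ((y * ξ : ℝ) : ℂ) + -I * x * ξ by push_cast; ring_nf; rw [I_sq]; ring,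
        Complex.exp_add, Complex.ofReal_exp]
    rw [this]; ring
  simp_rw [hline, integral_const_mul] at key
  have hg0 : ∀ x : ℝ, g x = cexp (-I * x * ξ) * h x := fun x ↦ rfl
  simp_rw [hg0] at key
  rw [key, ← mul_assoc, ← Complex.ofReal_mul, ← Real.exp_add, show -(y * ξ) + y * ξ = 0 by ring,
    Real.exp_zero, Complex.ofReal_one, one_mul]


/-- The constant `C` of the majorant is non-negative (evaluate at `0`). [folklore] -/
theorem const_nonneg_of_bound (hb : ∀ z : ℂ, ‖h z‖ ≤ C * Real.exp |z.im| / (1 + |z.re|) ^ N) : 0 ≤ C := by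
  have := (norm_nonneg _).trans (hb 0)
  simp at this
  linarith

/-- `‖∫ e^{-iuξ} h(u + iy) du‖ ≤ C e^{|y|} ∫ (1+|u|)^{-N} du`. [folklore] -/
theorem norm_integral_cexp_mul_line_le
    (hb : ∀ z : ℂ, ‖h z‖ ≤ C * Real.exp |z.im| / (1 + |z.re|) ^ N) (hN : 2 ≤ N) (ξ y : ℝ) :
    ‖∫ u : ℝ, cexp (-I * u * ξ) * h (u + y * I)‖ ≤
      C * Real.exp |y| * ∫ u : ℝ, 1 / (1 + |u|) ^ N := by
  rw [← integral_const_mul]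
  refine (norm_integral_le_integral_norm _).trans (integral_mono_of_nonneg (ae_of_all _ fun u ↦ norm_nonneg _)
    ((integrable_inv_one_add_abs_pow hN).const_mul _) (ae_of_all _ fun u ↦ ?_))
  have hexp : ‖cexp (-I * u * ξ)‖ = 1 := by
    rw [Complex.norm_exp]; simp [Complex.mul_re]
  simp only [norm_mul, hexp, one_mul]
  have := hb (u + y * I)
  simp only [add_im, ofReal_im, mul_im, ofReal_re, I_im, mul_one, I_re, mul_zero, add_zero, zero_add,
    add_re, mul_re, sub_self] at this
  refine this.trans_eq ?_
  ring

/-- **Paley–Wiener, easy half**: the transform `∫ e^{-iuξ} h(u) du` vanishes for `|ξ| > 1` (let the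
line of integration recede to `im z → ∓∞` in `integral_cexp_mul_shift`). [folklore] -/
theorem integral_cexp_mul_eq_zero_of_one_lt_abs (hh : Differentiable ℂ h)
    (hb : ∀ z : ℂ, ‖h z‖ ≤ C * Real.exp |z.im| / (1 + |z.re|) ^ N) (hN : 2 ≤ N) {ξ : ℝ} (hξ : 1 < |ξ|) :
    ∫ u : ℝ, cexp (-I * u * ξ) * h u = 0 := by
  set F : ℂ := ∫ u : ℝ, cexp (-I * u * ξ) * h u with hF
  set J : ℝ := ∫ u : ℝ, 1 / (1 + |u|) ^ N with hJ
  have hJ0 : 0 ≤ J := integral_nonneg fun u ↦ by positivity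
  have hC := const_nonneg_of_bound hb
  -- `‖F‖ ≤ C J e^{yξ + |y|}` for every real `y`
  have hbound : ∀ y : ℝ, ‖F‖ ≤ C * J * Real.exp (y * ξ + |y|) := by
    intro y
    have h1 := integral_cexp_mul_shift hh hb hN ξ y
    have h2 := norm_integral_cexp_mul_line_le hb hN ξ y
    rw [h1, norm_mul, Complex.norm_real, Real.norm_of_nonneg (Real.exp_pos _).le] at h2
    have h3 : ‖F‖ = Real.exp (y * ξ) * (Real.exp (-(y * ξ)) * ‖F‖) := by
      rw [← mul_assoc, ← Real.exp_add, add_neg_cancel, Real.exp_zero, one_mul]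
    rw [h3, Real.exp_add]
    calc Real.exp (y * ξ) * (Real.exp (-(y * ξ)) * ‖F‖) ≤ Real.exp (y * ξ) * (C * Real.exp |y| * J) :=
          mul_le_mul_of_nonneg_left h2 (Real.exp_pos _).le
      _ = C * J * (Real.exp (y * ξ) * Real.exp |y|) := by ring
  -- choose the sign of `y` so that `yξ + |y| = -|y| (|ξ| - 1) → -∞`
  by_contra hne
  have hFpos : 0 < ‖F‖ := norm_pos_iff.mpr hne
  have hCJ : 0 < C * J := by
    by_contra h0
    have : ‖F‖ ≤ 0 := (hbound 0).trans (by simp; nlinarith [not_lt.mp h0])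
    linarith
  -- `e^{-s(|ξ|-1)} C J < ‖F‖` for large `s`
  have hlim : Tendsto (fun s : ℝ ↦ C * J * Real.exp (-(s * (|ξ| - 1)))) atTop (𝓝 0) := by
    have : Tendsto (fun s : ℝ ↦ -(s * (|ξ| - 1))) atTop atBot := by
      have h1 : Tendsto (fun s : ℝ ↦ s * (|ξ| - 1)) atTop atTop := tendsto_id.atTop_mul_const (by linarith)
      exact tendsto_neg_atTop_atBot.comp h1
    simpa using (Real.tendsto_exp_atBot.comp this).const_mul (C * J)
  obtain ⟨s, hs⟩ := ((hlim.eventually (gt_mem_nhds hFpos)).and (eventually_ge_atTop 0)).exists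
  -- take `y = -s · sign ξ`
  have key : ‖F‖ ≤ C * J * Real.exp (-(s * (|ξ| - 1))) := by
    rcases le_or_gt 0 ξ with hξ0 | hξ0
    · have := hbound (-s)
      rw [abs_of_nonneg hξ0]
      have e : -s * ξ + |(-s)| = -(s * (ξ - 1)) := by rw [abs_neg, abs_of_nonneg hs.2]; ring
      rwa [e] at this
    · have := hbound s
      rw [abs_of_neg hξ0]
      rwa [show s * ξ + |s| = -(s * (-ξ - 1)) by rw [abs_of_nonneg hs.2]; ring] at this
  linarith [hs.1]

/-- If `h(conj z) = conj h(z)` then `h` is real on the real axis. [folklore] -/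
theorem conj_apply_ofReal (hrefl : ∀ z : ℂ, h (conj z) = conj (h z)) (u : ℝ) : conj (h u) = h u := by
  have := hrefl u
  rw [Complex.conj_ofReal] at this
  exact this.symm

/-- **The transform is real and even** when `h(conj z) = conj h(z)` and `h(-z) = h(z)`:
`conj (∫ e^{-iuξ} h) = ∫ e^{-iuξ} h` and `(∫ e^{-iu(-ξ)} h) = ∫ e^{-iuξ} h`. [folklore] -/
theorem integral_cexp_mul_even (heven : ∀ z : ℂ, h (-z) = h z) (ξ : ℝ) :
    ∫ u : ℝ, cexp (-I * u * (-ξ)) * h u = ∫ u : ℝ, cexp (-I * u * ξ) * h u := by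
  rw [← integral_neg_eq_self]
  refine integral_congr_ae (ae_of_all _ fun u ↦ ?_)
  simp only
  rw [show ((-u : ℝ) : ℂ) = -(u : ℂ) by push_cast; ring, heven]
  congr 1
  congr 1
  ring

/-- Under `h(conj z) = conj h(z)` and evenness the transform is real:
`conj (∫ e^{-iuξ} h) = ∫ e^{-iuξ} h`. [folklore] -/
theorem conj_integral_cexp_mul (hrefl : ∀ z : ℂ, h (conj z) = conj (h z)) (heven : ∀ z : ℂ, h (-z) = h z) (ξ : ℝ) :
    conj (∫ u : ℝ, cexp (-I * u * ξ) * h u) = ∫ u : ℝ, cexp (-I * u * ξ) * h u := by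
  rw [← integral_conj, ← integral_cexp_mul_even heven ξ]
  refine integral_congr_ae (ae_of_all _ fun u ↦ ?_)
  simp only [map_mul, conj_apply_ofReal hrefl]
  congr 1
  rw [← Complex.exp_conj]
  congr 1
  simp only [map_mul, map_neg, Complex.conj_I, Complex.conj_ofReal]
  ring

/-- The transform is bounded by `C ∫ (1+|u|)^{-N}`. [folklore] -/
theorem norm_integral_cexp_mul_le
    (hb : ∀ z : ℂ, ‖h z‖ ≤ C * Real.exp |z.im| / (1 + |z.re|) ^ N) (hN : 2 ≤ N) (ξ : ℝ) :
    ‖∫ u : ℝ, cexp (-I * u * ξ) * h u‖ ≤ C * ∫ u : ℝ, 1 / (1 + |u|) ^ N := by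
  have := norm_integral_cexp_mul_line_le hb hN ξ 0
  simpa using this

/-- **The twisted line integral of the scaled kernel** (the computation behind the `D`-terms of
Soundararajan's (7)): for `L > 0` and real `t₀, η, ω`,
`∫ e^{-iωy} h(L(y − t₀) − iLη) dy = L⁻¹ e^{-iωt₀} e^{ηω} ∫ e^{-iu(ω/L)} h(u) du`;
in particular it vanishes when `|ω| > L` (Paley–Wiener) and, for `ω = log n`, equals
`L⁻¹ n^{-it₀} n^{η} ĥ(log n/L)` — independent of the distance `η` of the line of integration from the
critical line. [folklore] -/
theorem integral_cexp_mul_scaled_shift (hh : Differentiable ℂ h)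
    (hb : ∀ z : ℂ, ‖h z‖ ≤ C * Real.exp |z.im| / (1 + |z.re|) ^ N) (hN : 2 ≤ N)
    {L : ℝ} (hL : 0 < L) (t₀ η ω : ℝ) :
    ∫ y : ℝ, cexp (-I * y * ω) * h (L * (y - t₀) - L * η * I) =
      (L⁻¹ : ℂ) * cexp (-I * t₀ * ω) * Real.exp (η * ω) * ∫ u : ℝ, cexp (-I * u * (ω / L)) * h u := by
  have hL0 : (L : ℂ) ≠ 0 := by exact_mod_cast hL.ne'
  have ecast : ∀ u : ℝ, (u : ℂ) + ((-(L * η) : ℝ) : ℂ) * I = u - L * η * I := by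
    intro u; push_cast; ring
  -- A: complex shift to the line `im = -Lη`
  have hA : ∫ u : ℝ, cexp (-I * u * (ω / L)) * h (u - L * η * I) =
      Real.exp (η * ω) * ∫ u : ℝ, cexp (-I * u * (ω / L)) * h u := by
    have := integral_cexp_mul_shift hh hb hN (ω / L) (-(L * η))
    simp_rw [ecast] at this
    push_cast at this
    rw [this]
    congr 1
    rw [Complex.ofReal_exp]
    congr 1
    push_cast
    field_simp
  -- B: scale `u = L v`
  have hB : ∫ u : ℝ, cexp (-I * u * (ω / L)) * h (u - L * η * I) =
      L * ∫ v : ℝ, cexp (-I * v * ω) * h (L * v - L * η * I) := by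
    have h1 := MeasureTheory.Measure.integral_comp_mul_left
      (fun u : ℝ ↦ cexp (-I * u * (ω / L)) * h (u - L * η * I)) L
    have h2 : (fun v : ℝ ↦ cexp (-I * ((L * v : ℝ) : ℂ) * (ω / L)) * h (((L * v : ℝ) : ℂ) - L * η * I)) =
        fun v : ℝ ↦ cexp (-I * v * ω) * h (L * v - L * η * I) := by
      funext v
      have e1 : -I * ((L * v : ℝ) : ℂ) * (ω / L) = -I * v * ω := by
        push_cast; field_simp
      have e2 : ((L * v : ℝ) : ℂ) - L * η * I = L * v - L * η * I := by push_cast; ring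
      rw [e1, e2]
    rw [h2, abs_of_pos (inv_pos.mpr hL), Complex.real_smul] at h1
    rw [h1, ← mul_assoc]
    push_cast
    rw [mul_inv_cancel₀ hL0, one_mul]
  -- C: translate `v = y - t₀`
  have hC : ∫ v : ℝ, cexp (-I * v * ω) * h (L * v - L * η * I) =
      cexp (I * t₀ * ω) * ∫ y : ℝ, cexp (-I * y * ω) * h (L * (y - t₀) - L * η * I) := by
    rw [← integral_sub_right_eq_self (fun v : ℝ ↦ cexp (-I * v * ω) * h (L * v - L * η * I)) t₀,
      ← integral_const_mul]
    refine integral_congr_ae (ae_of_all _ fun y ↦ ?_)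
    simp only
    rw [← mul_assoc, ← Complex.exp_add]
    congr 1
    · congr 1; push_cast; ring
    · congr 1; push_cast; ring
  -- combine
  have hexp : cexp (-I * t₀ * ω) * cexp (I * t₀ * ω) = 1 := by
    rw [← Complex.exp_add, show -I * t₀ * ω + I * t₀ * ω = 0 by ring, Complex.exp_zero]
  have hL0 : (L : ℂ) ≠ 0 := by exact_mod_cast hL.ne'
  calc ∫ y : ℝ, cexp (-I * y * ω) * h (L * (y - t₀) - L * η * I)
      = (L⁻¹ : ℂ) * cexp (-I * t₀ * ω) * (L * (cexp (I * t₀ * ω) *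
          ∫ y : ℝ, cexp (-I * y * ω) * h (L * (y - t₀) - L * η * I))) := by
        rw [show (L⁻¹ : ℂ) * cexp (-I * t₀ * ω) * (L * (cexp (I * t₀ * ω) *
          ∫ y : ℝ, cexp (-I * y * ω) * h (L * (y - t₀) - L * η * I))) =
          ((L⁻¹ : ℂ) * L) * (cexp (-I * t₀ * ω) * cexp (I * t₀ * ω)) *
          ∫ y : ℝ, cexp (-I * y * ω) * h (L * (y - t₀) - L * η * I) by ring, hexp, inv_mul_cancel₀ hL0]
        ring
    _ = (L⁻¹ : ℂ) * cexp (-I * t₀ * ω) * Real.exp (η * ω) * ∫ u : ℝ, cexp (-I * u * (ω / L)) * h u := by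
        rw [← hC, ← hB, hA]; push_cast; ring


open intervalIntegral

/-- The scaled and shifted kernel on a horizontal line: pointwise bound
`‖h(L(y − t₀) − iLη)‖ ≤ C e^{L|η|}/(1 + L|y − t₀|)^N`. [folklore] -/
theorem norm_scaled_kernel_le (hb : ∀ z : ℂ, ‖h z‖ ≤ C * Real.exp |z.im| / (1 + |z.re|) ^ N)
    {L : ℝ} (hL : 0 < L) (t₀ η y : ℝ) :
    ‖h (L * (y - t₀) - L * η * I)‖ ≤ C * Real.exp (L * |η|) / (1 + L * |y - t₀|) ^ N := by
  have := hb (L * (y - t₀) - L * η * I)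
  have hre : ((L : ℂ) * (y - t₀) - L * η * I).re = L * (y - t₀) := by simp
  have him : ((L : ℂ) * (y - t₀) - L * η * I).im = -(L * η) := by simp
  rw [hre, him, abs_neg, abs_mul, abs_of_pos hL, abs_mul, abs_of_pos hL] at this
  exact this

/-- `∫ ‖h(L(y − t₀) − iLη)‖ dy ≤ C e^{L|η|} L⁻¹ ∫ (1+|u|)^{-N} du`. [folklore] -/
theorem integral_norm_scaled_kernel_le (hh : Differentiable ℂ h)
    (hb : ∀ z : ℂ, ‖h z‖ ≤ C * Real.exp |z.im| / (1 + |z.re|) ^ N) (hN : 2 ≤ N)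
    {L : ℝ} (hL : 0 < L) (t₀ η : ℝ) :
    Integrable (fun y : ℝ ↦ h (L * (y - t₀) - L * η * I)) ∧
    ∫ y : ℝ, ‖h (L * (y - t₀) - L * η * I)‖ ≤ C * Real.exp (L * |η|) * L⁻¹ * ∫ u : ℝ, 1 / (1 + |u|) ^ N := by
  -- the majorant `y ↦ C e^{L|η|} (1 + L|y - t₀|)^{-N}` and its integral
  have hmaj : Integrable (fun y : ℝ ↦ C * Real.exp (L * |η|) / (1 + L * |y - t₀|) ^ N) ∧
      ∫ y : ℝ, C * Real.exp (L * |η|) / (1 + L * |y - t₀|) ^ N =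
        C * Real.exp (L * |η|) * L⁻¹ * ∫ u : ℝ, 1 / (1 + |u|) ^ N := by
    have hI := integrable_inv_one_add_abs_pow hN
    -- substitution `u = L (y - t₀)`
    have hsub : ∀ (φ : ℝ → ℝ), (∫ y : ℝ, φ (L * (y - t₀))) = L⁻¹ * ∫ u : ℝ, φ u := by
      intro φ
      have h1 := MeasureTheory.Measure.integral_comp_mul_left (fun u : ℝ ↦ φ u) L
      rw [abs_of_pos (inv_pos.mpr hL), smul_eq_mul] at h1
      rw [← h1]
      exact integral_sub_right_eq_self (μ := volume) (fun y : ℝ ↦ φ (L * y)) t₀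
    have hint : Integrable fun y : ℝ ↦ 1 / (1 + |L * (y - t₀)|) ^ N := by
      have h1 : Integrable fun y : ℝ ↦ 1 / (1 + |L * y|) ^ N := by
        have := hI.comp_mul_left' hL.ne'
        simpa using this
      exact h1.comp_sub_right t₀
    constructor
    · have := hint.const_mul (C * Real.exp (L * |η|))
      refine this.congr (ae_of_all _ fun y ↦ ?_)
      simp only [abs_mul, abs_of_pos hL]; ring
    · have := hsub (fun u ↦ 1 / (1 + |u|) ^ N)
      simp only [abs_mul, abs_of_pos hL] at this
      calc ∫ y : ℝ, C * Real.exp (L * |η|) / (1 + L * |y - t₀|) ^ N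
          = C * Real.exp (L * |η|) * ∫ y : ℝ, 1 / (1 + L * |y - t₀|) ^ N := by
            rw [← MeasureTheory.integral_const_mul]; congr 1; funext y; ring
        _ = C * Real.exp (L * |η|) * L⁻¹ * ∫ u : ℝ, 1 / (1 + |u|) ^ N := by rw [this]; ring
  have hc : Continuous fun y : ℝ ↦ h (L * (y - t₀) - L * η * I) := hh.continuous.comp (by fun_prop)
  have hint : Integrable fun y : ℝ ↦ h (L * (y - t₀) - L * η * I) :=
    hmaj.1.mono' hc.aestronglyMeasurable (ae_of_all _ fun y ↦ norm_scaled_kernel_le hb hL t₀ η y)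
  refine ⟨hint, ?_⟩
  rw [← hmaj.2]
  exact integral_mono_of_nonneg (ae_of_all _ fun y ↦ norm_nonneg _) hmaj.1
    (ae_of_all _ fun y ↦ norm_scaled_kernel_le hb hL t₀ η y)

/-- **Truncating a line integral**: if `‖f y‖ ≤ g y` off `[T₁, T₂]` (`g ≥ 0` integrable), then
`‖∫_{T₁}^{T₂} f − ∫_ℝ f‖ ≤ ∫_ℝ g`. [folklore] -/
theorem norm_intervalIntegral_sub_integral_le {f : ℝ → ℂ} {g : ℝ → ℝ} {T₁ T₂ : ℝ} (hT : T₁ ≤ T₂)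
    (hf : Integrable f) (hg : Integrable g) (hg0 : ∀ y, 0 ≤ g y)
    (hfg : ∀ y, y ∉ Set.Ioc T₁ T₂ → ‖f y‖ ≤ g y) :
    ‖(∫ y in T₁..T₂, f y) - ∫ y, f y‖ ≤ ∫ y, g y := by
  rw [intervalIntegral.integral_of_le hT, ← integral_add_compl (measurableSet_Ioc) hf,
    show ((∫ y in Set.Ioc T₁ T₂, f y) - ((∫ y in Set.Ioc T₁ T₂, f y) + ∫ y in (Set.Ioc T₁ T₂)ᶜ, f y)) =
      -∫ y in (Set.Ioc T₁ T₂)ᶜ, f y by ring, norm_neg]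
  calc ‖∫ y in (Set.Ioc T₁ T₂)ᶜ, f y‖ ≤ ∫ y in (Set.Ioc T₁ T₂)ᶜ, ‖f y‖ := norm_integral_le_integral_norm _
    _ ≤ ∫ y in (Set.Ioc T₁ T₂)ᶜ, g y := by
        refine setIntegral_mono_on hf.norm.integrableOn hg.integrableOn (measurableSet_Ioc.compl) ?_
        intro y hy; exact hfg y hy
    _ ≤ ∫ y, g y := setIntegral_le_integral hg (ae_of_all _ hg0)

end Literature.Analysis.Fourier

end
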